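import Summits.BirchSwinnertonDyer.BirchSwinnertonDyer.Theorems.BiquadraticEisensteinDescentHeegnerTwistCouplingInSupplySymbolicMonskyEvenDesignExists
import Summits.BirchSwinnertonDyer.BirchSwinnertonDyer.Theorems.BiquadraticEisensteinDescentSymbolicMonskyEvenKernelDefs
import HarnessLib

set_option linter.dupNamespace false -- `Summit.BirchSwinnertonDyer.BirchSwinnertonDyer.Theorems.…` (summit = sub)
set_option autoImplicit false

/-!
# Crux `HeegnerTwistCouplingInSupply` (stmt-BirchSwinnertonDyer-21381) — EVEN THEOREM A on the reviewed EVEN PENCIL `SymbData.evenPencil`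

Route `BiquadraticEisensteinDescent` (cell `pub/bsd-wall`, width seat `bsd-wall-cm-bed-w3` g23; `--supports` 21381, helper). Instantiates the
def-free existence theorem `…SymbolicMonskyEvenDesignExists.exists_patternFree_even_design` (its `W` is any subspace with the pencil membership)
with the reviewed definitions of `…SymbolicMonskyEvenKernelDefs` (`evenVirtualKernel`, `evenTwist`, `evenPencil`):
* `mem_evenVirtualKernel_iff`, `mem_evenPencil_iff` — membership unfolded;
* ★★ `exists_patternFree_even_design_pencil` — for ANY base datum and `δ` with `(δ, 1+δ) ∉ T_δ(𝒦_ev)`: if `finrank (evenPencil δ) = 2τ` and the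
  pencil meets `V × 0`, `0 × V` and the diagonal in dimension `≤ τ`, a pattern-free Heegner recipe with `τ + 1` auxiliary primes exists on the EVEN
  base `E_{2·P₀⋯P_k}` (`heegnerK ∧ ∀ pat, det M_even = 1`) — the even twin of THEOREM A `exists_patternFree_design` (p742384) in the same shape.

HONEST FRAMING: RUNG-LEVEL corner layer (even congruent `j = 1728` families); instances still need located primes and the print inputs; the crux as
stated (C⁺), its registered stubs and BSD are NOT touched; nothing is closed. THEOREMS ONLY.
Reference: [HeathBrown1994] appendix (Monsky), typescript p. 41 L20–L36.
-/

namespace Summit.BirchSwinnertonDyer.BirchSwinnertonDyer.Theorems.SymbolicMonsky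

section EvenPencil

open Matrix Module

variable {k : ℕ} (base : SymbData (k + 1))

/-- Membership in the even virtual kernel, unfolded. -/
theorem mem_evenVirtualKernel_iff (p : (Fin (k + 1) → ZMod 2) × (Fin (k + 1) → ZMod 2)) :
    p ∈ base.evenVirtualKernel ↔
      (∀ i, (∑ j, bz (base.neg i j) * (p.1 j + p.1 i)) + bz (negNegOne (base.cls i)) * (∑ j, bz (negNegOne (base.cls j)) * p.1 j) +
        bz (negTwo (base.cls i)) * p.1 i + bz (negNegOne (base.cls i)) * p.2 i = 0) ∧
      (∀ i, bz (negTwo (base.cls i)) * p.1 i + (∑ j, bz (base.neg i j) * (p.2 j + p.2 i)) + bz (negNegOne (base.cls i)) * p.2 i +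
        bz (negTwo (base.cls i)) * p.2 i + bz (negNegOne (base.cls i)) * (∑ j, bz (negNegOne (base.cls j)) * p.1 j) = 0) := Iff.rfl

/-- The even twist, unfolded. -/
theorem evenTwist_apply (δ : Fin (k + 1) → ZMod 2) (p : (Fin (k + 1) → ZMod 2) × (Fin (k + 1) → ZMod 2)) :
    base.evenTwist δ p = (fun i => p.2 i + (∑ j, bz (negNegOne (base.cls j)) * p.1 j) * (1 + δ i), p.1) := rfl

/-- Membership in the even pencil: `p = (v + ⟨m,u⟩(1+δ) + γδ, u + γ(1+δ))` for an even kernel pair `(u, v)` and `γ ∈ 𝔽₂`. -/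
theorem mem_evenPencil_iff (δ : Fin (k + 1) → ZMod 2) (p : (Fin (k + 1) → ZMod 2) × (Fin (k + 1) → ZMod 2)) :
    p ∈ base.evenPencil δ ↔
      ∃ (u v : Fin (k + 1) → ZMod 2) (γ : ZMod 2),
        (∀ b, (∑ b', bz (base.neg b b') * (u b' + u b)) +
          bz (negNegOne (base.cls b)) * (∑ b', bz (negNegOne (base.cls b')) * u b') +
          bz (negTwo (base.cls b)) * u b + bz (negNegOne (base.cls b)) * v b = 0) ∧
        (∀ b, bz (negTwo (base.cls b)) * u b + (∑ b', bz (base.neg b b') * (v b' + v b)) +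
          bz (negNegOne (base.cls b)) * v b + bz (negTwo (base.cls b)) * v b +
          bz (negNegOne (base.cls b)) * (∑ b', bz (negNegOne (base.cls b')) * u b') = 0) ∧
        p = (fun b => v b + (∑ b', bz (negNegOne (base.cls b')) * u b') * (1 + δ b) + γ * δ b,
             fun b => u b + γ * (1 + δ b)) := by
  unfold SymbData.evenPencil
  rw [Submodule.mem_sup]
  constructor
  · rintro ⟨y, hy, z, hz, rfl⟩
    rw [Submodule.mem_map] at hy
    obtain ⟨q, hq, rfl⟩ := hy
    rw [Submodule.mem_span_singleton] at hz
    obtain ⟨γ, rfl⟩ := hz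
    rw [mem_evenVirtualKernel_iff] at hq
    refine ⟨q.1, q.2, γ, hq.1, hq.2, ?_⟩
    rw [evenTwist_apply]
    refine Prod.ext ?_ ?_
    · funext b; simp [Pi.add_apply, Pi.smul_apply]
    · funext b; simp [Pi.add_apply, Pi.smul_apply]
  · rintro ⟨u, v, γ, hE1, hE2, rfl⟩
    refine ⟨base.evenTwist δ (u, v), Submodule.mem_map_of_mem ((mem_evenVirtualKernel_iff base (u, v)).2 ⟨hE1, hE2⟩),
      γ • (δ, fun i => 1 + δ i), Submodule.mem_span_singleton.2 ⟨γ, rfl⟩, ?_⟩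
    rw [evenTwist_apply]
    refine Prod.ext ?_ ?_
    · funext b; simp [Pi.add_apply, Pi.smul_apply]
    · funext b; simp [Pi.add_apply, Pi.smul_apply]

/-- ★★ **EVEN THEOREM A on the reviewed even pencil.** For ANY base datum `base : SymbData (k+1)` (even base `n₀ = 2·P₀⋯P_k`) and `δ` with
`(δ, 1+δ) ∉ T_δ(𝒦_ev)`: if the even pencil `W_ev(δ) = base.evenPencil δ` has dimension `2τ` and meets `V × 0`, `0 × V` and the diagonal in dimension
`≤ τ` each, then there are cells `c₁ :: rest`, `|rest| = τ`, with `heegnerK base (c₁ :: rest)` and `det M_even(base, c₁ :: rest, pat) = 1` for EVERY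
mutual pattern — a PATTERN-FREE HEEGNER RECIPE WITH `τ + 1` AUXILIARY PRIMES on the even base.
[cite: HeathBrown1994SelmerCongruentII, Appendix (Monsky), typescript p. 41 L20–L36] -/
theorem exists_patternFree_even_design_pencil (δ : Fin (k + 1) → ZMod 2) (τ : ℕ)
    (hδ : ((δ, fun i => 1 + δ i) : (Fin (k + 1) → ZMod 2) × (Fin (k + 1) → ZMod 2)) ∉
      base.evenVirtualKernel.map (base.evenTwist δ))
    (hdim : finrank (ZMod 2) ↥(base.evenPencil δ) = 2 * τ)
    (h1 : finrank (ZMod 2) ↥(base.evenPencil δ ⊓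
      LinearMap.ker (LinearMap.snd (ZMod 2) (Fin (k + 1) → ZMod 2) (Fin (k + 1) → ZMod 2))) ≤ τ)
    (h2 : finrank (ZMod 2) ↥(base.evenPencil δ ⊓
      LinearMap.ker (LinearMap.fst (ZMod 2) (Fin (k + 1) → ZMod 2) (Fin (k + 1) → ZMod 2))) ≤ τ)
    (h3 : finrank (ZMod 2) ↥(base.evenPencil δ ⊓ LinearMap.ker (LinearMap.fst (ZMod 2) (Fin (k + 1) → ZMod 2) (Fin (k + 1) → ZMod 2) +
      LinearMap.snd (ZMod 2) (Fin (k + 1) → ZMod 2) (Fin (k + 1) → ZMod 2))) ≤ τ) :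
    ∃ (c₁ : AuxCell) (rest : List AuxCell), rest.length = τ ∧ heegnerK base (c₁ :: rest) = true ∧
      ∀ pat : ℕ → ℕ → Bool, (dataK base (c₁ :: rest) pat).monskyEvenS.det = 1 := by
  refine exists_patternFree_even_design base δ τ (base.evenPencil δ) (fun p => mem_evenPencil_iff base δ p) ?_ hdim h1 h2 h3
  intro u v hE1 hE2 hu hv
  apply hδ
  rw [Submodule.mem_map]
  refine ⟨(u, v), (mem_evenVirtualKernel_iff base (u, v)).2 ⟨hE1, hE2⟩, ?_⟩
  rw [evenTwist_apply]
  refine Prod.ext ?_ ?_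
  · funext b
    show v b + (∑ b', bz (negNegOne (base.cls b')) * u b') * (1 + δ b) = δ b
    rw [hv b]
    have h2' : ∀ x : ZMod 2, x + x = 0 := zmod_two_add_self
    linear_combination h2' ((∑ b', bz (negNegOne (base.cls b')) * u b') * (1 + δ b))
  · funext b
    exact hu b

end EvenPencil

end Summit.BirchSwinnertonDyer.BirchSwinnertonDyer.Theorems.SymbolicMonsky
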